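import Literature.Analysis.InnerProduct.ClosedHilbertComplexHodgeTheory
import HarnessLib

/-!
# The Green (solution) operator `K` of the Laplacian of a Hilbert complex: characterisation by
# `□Kf = f − P_𝔥 f`, `Kf ⊥ 𝔥`; `K|_𝔥 = 0`, `K□ = 1 − P_𝔥`, `K = K* ≥ 0`; the Hodge projections
# `P_𝔅 = TT*K`, `P_{𝔅*} = S*SK`; `K` commutes with the differentials; bounds from the basic estimate
# (Arnold–Falk–Winther, Bull. AMS 47 (2010), §3.2.1; Hörmander 1965 §1.1)

Layer `Literature/Analysis/InnerProduct`, namespace `Literature.Analysis.InnerProduct`; sequel BY NAME of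
`HilbertComplexLaplacian.lean` (row g31-#1: `inner_laplacian_left`, `re_inner_laplacian_self`,
`laplacian_domain_le_adjoint_domain`, `laplacian_domain_le_domain`, `isSymmetric_laplacian`) and of
`ClosedHilbertComplexHodgeTheory.lean` (row g31-#2: `range_laplacian_le_orthogonal_harmonic`,
`eq_zero_of_laplacian_eq_zero_of_mem_orthogonal`, and the EXISTENCE of the Green operator for a closed complex,
`exists_green_operator`, whose first property is the hypothesis `hK` below). Lane `lit-hodgefound` (Track 2
foundations library), prover seat `lit-hodgefound-p06` (generation 31), self-proposed row g31-#9. THEOREMS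
ONLY (no definition, no named fact). As in the previous rows the Laplacian `□ = TT* + S*S` of the closed
densely defined complex `E →T F →S G` (`Im T ⊆ Ker S`) is any `L : F →ₗ.[𝕜] F` with the domain/value
hypotheses `hdom`/`hval`, the harmonic space is `𝔥 = Ker S ⊓ Ker T*` =
`(LinearMap.ker S.toFun).map S.domain.subtype ⊓ (LinearMap.ker T†.toFun).map T†.domain.subtype`, and a Green
operator is any bounded `K : F →L[𝕜] F` with
`hK : ∀ f, Kf ∈ Dom □ ∧ Kf ⊥ 𝔥 ∧ f − □Kf ∈ 𝔥` (the defining property "`u = Kf ∈ D_L`, `Lu = f − P_𝔥 f`,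
`u ⊥ 𝔥`"; such a `K` exists for a closed complex by `exists_green_operator`, and is unique by `green_unique`).

## Source, verbatim (D. N. Arnold, R. S. Falk, R. Winther, *Finite element exterior calculus: from Hodge theory
to numerical stability*, Bull. AMS 47 (2010), §3.2.1; held text `paper:arxiv-0906.4325`, p0016)

"Thus Theorem 3.1 establishes that for any `f ∈ W^k` there is a unique `u ∈ D_L` such that `Lu = f − P_𝔥 f`
and `u ⊥ 𝔥^k`. We define `Kf = u`, so the solution operator `K : W^k → W^k` is a bounded linear operator
mapping into `D_L`. The solution to the mixed formulation is `σ = d*Kf`, `u = Kf`, `p = P_𝔥 f`. The mixed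
formulation is also intimately connected to the Hodge decomposition. Since `dσ ∈ 𝔅^k`, `p ∈ 𝔥^k`, and
`d*du ∈ 𝔅*_k`, the expression `f = dσ + p + d*du` is precisely the Hodge decomposition of `f`. In other words
`P_𝔅 = dd*K`, `P_{𝔅*} = d*dK`, where `P_𝔅` and `P_{𝔅*}` are the `W^k`-orthogonal projections onto `𝔅^k` and
`𝔅*_k`, respectively. We also note that `K` commutes with `d` and `d*` in the sense that `dKf = Kdf`,
`f ∈ V^k`, `d*Kg = Kd*g`, `g ∈ V*_k`. Indeed, if `f ∈ V^k` and `u = Kf`, then `u ∈ D_L`, which implies that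
`du ∈ V^{k+1} ∩ V*_{k+1}`. Also `d*u ∈ V^{k−1}`, so `d*du = f − P_𝔥 f − dd*u ∈ V^k`. This shows that
`du ∈ D_L`. Clearly `Ldu = (dd* + d*d)du = dd*du = d(dd* + d*d)u = dLu = df`, …"

and Theorem 3.1 (p0016): "for any `f ∈ W^k`, there exists a unique `(σ, u, p) ∈ V^{k−1} × V^k × 𝔥^k`
satisfying (the mixed formulation). Moreover `‖σ‖_V + ‖u‖_V + ‖p‖ ≤ c‖f‖`, where `c` is a constant depending
only on the Poincaré constant `c_P`". For the quantitative bound we use Hörmander's basic estimate (1.1.4)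
`‖g‖² ≤ C²(‖T*g‖² + ‖Sg‖²)` on `D_{T*} ∩ D_S ∩ 𝔥^⊥` (Acta Math. 113 (1965) Thm 1.1.2; row g31-#7): it gives
`‖Kf‖ ≤ C²‖f‖`, `‖T*Kf‖ ≤ |C|‖f‖`, `‖SKf‖ ≤ |C|‖f‖`.

## What is proved (all over `𝕜 = ℝ` or `ℂ`)

* §1 consequences of `hK` alone: **`green_unique`**, `green_apply_eq_zero_of_mem_harmonic` (`K|_𝔥 = 0`),
  `green_laplacian_apply` (`K□u = u` for `u ∈ D_□ ∩ 𝔥^⊥`), `laplacian_green_eq_sub_starProjection`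
  (`□Kf = f − P_𝔥 f`), `inner_green_eq_inner_laplacian_green` (`(Kf, g) = (□Kf, Kg)`), **`green_symmetric`**,
  `re_inner_green_self_eq` (`Re (Kf, f) = ‖T*Kf‖² + ‖SKf‖²`), **`green_isPositive`**, `isSelfAdjoint_green`.
* §2 the Hodge projections: **`eq_laplacian_green_add`** (`f = TT*Kf + S*SKf + (f − □Kf)`),
  **`sub_adjoint_green_mem_orthogonal_range`** (`f − TT*Kf ⊥ Im T`, with `TT*Kf ∈ Im T`: "`P_𝔅 = dd*K`", stated
  as `starProjection_closure_range_eq` for the closed subspace `cl Im T`, which is `Im T` for a closed complex),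
  and dually **`sub_apply_green_mem_orthogonal_range_adjoint`** / `starProjection_closure_range_adjoint_eq`
  ("`P_{𝔅*} = d*dK`").
* §3 commutation: **`apply_green_eq_green_apply`** (`SKf = K′Sf` for `f ∈ D_S`, `K′` a Green operator of the
  next Laplacian `SS* + U*U` of `F →S G →U H`) with its `K′`-free core `laplacian_next_apply_green`
  (`SKf ∈ D_{□′}` and `□′(SKf) = Sf`), and dually **`adjoint_green_eq_green_adjoint`** (`T*Kg = K₀T*g` for
  `g ∈ D_{T*}`, `K₀` a Green operator of `RR* + T*T` on `E`) with `laplacian_prev_adjoint_green`.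
* §4 bounds under (1.1.4): **`norm_green_le_of_basic_estimate`** (`‖Kf‖ ≤ C²‖f‖`),
  `opNorm_green_le_of_basic_estimate`, `norm_adjoint_green_le_of_basic_estimate` (`‖T*Kf‖ ≤ |C|‖f‖`),
  `norm_apply_green_le_of_basic_estimate` (`‖SKf‖ ≤ |C|‖f‖`).

## References

* [ArnoldFalkWinther2010] D. N. Arnold, R. S. Falk, R. Winther, *Finite element exterior calculus: from Hodge
  theory to numerical stability*, Bull. AMS 47 (2010), §3.2.1 (the solution operator `K`, `P_𝔅 = dd*K`,
  `P_{𝔅*} = d*dK`, `dK = Kd`), Thm 3.1 (bounds).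
* [Hormander1965] L. Hörmander, *L² estimates and existence theorems for the ∂̄ operator*, Acta Math. 113
  (1965), §1.1 Thm 1.1.2, (1.1.4) (the basic estimate used for the bounds).
* [BruningLesch1992] J. Brüning, M. Lesch, *Hilbert complexes*, J. Funct. Anal. 108 (1992), §2 (2.14),
  Lemma 2.2, Cor. 2.5 (the Laplacian and the Hodge decomposition used, through rows g31-#1/#2).
-/

noncomputable section

open scoped InnerProductSpace LinearPMap

namespace Literature.Analysis.InnerProduct

variable {𝕜 E F G : Type*} [RCLike 𝕜]
variable [NormedAddCommGroup E] [InnerProductSpace 𝕜 E] [CompleteSpace E]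
variable [NormedAddCommGroup F] [InnerProductSpace 𝕜 F] [CompleteSpace F]
variable [NormedAddCommGroup G] [InnerProductSpace 𝕜 G] [CompleteSpace G]
variable {T : E →ₗ.[𝕜] F} {S : F →ₗ.[𝕜] G} {L : F →ₗ.[𝕜] F} {K : F →L[𝕜] F}

omit [CompleteSpace F] [CompleteSpace G] in
/-- An element of a subspace orthogonal to that subspace vanishes. [folklore] -/
private theorem eq_zero_of_mem_of_mem_orthogonal {H : Submodule 𝕜 F} {y : F} (hy : y ∈ H) (hyo : y ∈ Hᗮ) :
    y = 0 :=
  inner_self_eq_zero.1 ((Submodule.mem_orthogonal _ _).1 hyo y hy)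

/-! ### §1 What the defining property `□Kf = f − P_𝔥 f`, `Kf ⊥ 𝔥` implies -/

section Basic

/-- **`□u ∈ 𝔥` and `u ⊥ 𝔥` force `u = 0`** (for `u ∈ D_□`): `□u ∈ Im □ ⊆ 𝔥^⊥`, so `□u = 0`, `u ∈ Ker □ = 𝔥`.
[cite: ArnoldFalkWinther2010, §3.2.1 (uniqueness in "there is a unique `u ∈ D_L` such that `Lu = f − P_𝔥 f`
and `u ⊥ 𝔥`")] -/
theorem eq_zero_of_laplacian_mem_harmonic_of_mem_orthogonal (hdT : Dense (T.domain : Set E))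
    (hdS : Dense (S.domain : Set F)) (hcS : S.IsClosed)
    (hdom : ∀ x : F, x ∈ L.domain ↔ (∃ hxT : x ∈ T†.domain, T† ⟨x, hxT⟩ ∈ T.domain) ∧
      (∃ hxS : x ∈ S.domain, S ⟨x, hxS⟩ ∈ S†.domain))
    (hval : ∀ (x : L.domain) (hxT : (x : F) ∈ T†.domain) (hTx : T† ⟨x, hxT⟩ ∈ T.domain)
      (hxS : (x : F) ∈ S.domain) (hSx : S ⟨x, hxS⟩ ∈ S†.domain),
      L x = T ⟨T† ⟨x, hxT⟩, hTx⟩ + S† ⟨S ⟨x, hxS⟩, hSx⟩)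
    (u : L.domain)
    (hLu : L u ∈ (LinearMap.ker S.toFun).map S.domain.subtype ⊓ (LinearMap.ker T†.toFun).map T†.domain.subtype)
    (hu : (u : F) ∈ ((LinearMap.ker S.toFun).map S.domain.subtype ⊓
      (LinearMap.ker T†.toFun).map T†.domain.subtype)ᗮ) :
    u = 0 := by
  have h0 : L u = 0 := eq_zero_of_mem_of_mem_orthogonal hLu
    (range_laplacian_le_orthogonal_harmonic hdT hdS hcS hdom hval (LinearMap.mem_range_self _ u))
  exact eq_zero_of_laplacian_eq_zero_of_mem_orthogonal hdT hdS hdom hval u h0 hu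

/-- **Uniqueness of the Green operator**: two bounded operators with `Kf ∈ D_□`, `Kf ⊥ 𝔥`, `f − □Kf ∈ 𝔥` for
all `f` coincide. [cite: ArnoldFalkWinther2010, §3.2.1 ("there is a unique `u ∈ D_L` … We define `Kf = u`")] -/
theorem green_unique (hdT : Dense (T.domain : Set E)) (hdS : Dense (S.domain : Set F)) (hcS : S.IsClosed)
    (hdom : ∀ x : F, x ∈ L.domain ↔ (∃ hxT : x ∈ T†.domain, T† ⟨x, hxT⟩ ∈ T.domain) ∧
      (∃ hxS : x ∈ S.domain, S ⟨x, hxS⟩ ∈ S†.domain))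
    (hval : ∀ (x : L.domain) (hxT : (x : F) ∈ T†.domain) (hTx : T† ⟨x, hxT⟩ ∈ T.domain)
      (hxS : (x : F) ∈ S.domain) (hSx : S ⟨x, hxS⟩ ∈ S†.domain),
      L x = T ⟨T† ⟨x, hxT⟩, hTx⟩ + S† ⟨S ⟨x, hxS⟩, hSx⟩)
    {K₁ K₂ : F →L[𝕜] F}
    (hK₁ : ∀ f : F, ∃ h : K₁ f ∈ L.domain,
      K₁ f ∈ ((LinearMap.ker S.toFun).map S.domain.subtype ⊓ (LinearMap.ker T†.toFun).map T†.domain.subtype)ᗮ ∧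
      f - L ⟨K₁ f, h⟩ ∈ (LinearMap.ker S.toFun).map S.domain.subtype ⊓
        (LinearMap.ker T†.toFun).map T†.domain.subtype)
    (hK₂ : ∀ f : F, ∃ h : K₂ f ∈ L.domain,
      K₂ f ∈ ((LinearMap.ker S.toFun).map S.domain.subtype ⊓ (LinearMap.ker T†.toFun).map T†.domain.subtype)ᗮ ∧
      f - L ⟨K₂ f, h⟩ ∈ (LinearMap.ker S.toFun).map S.domain.subtype ⊓
        (LinearMap.ker T†.toFun).map T†.domain.subtype) :
    K₁ = K₂ := by
  ext f
  obtain ⟨h₁, ho₁, hp₁⟩ := hK₁ f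
  obtain ⟨h₂, ho₂, hp₂⟩ := hK₂ f
  have hd : (⟨K₁ f, h₁⟩ : L.domain) - ⟨K₂ f, h₂⟩ = 0 := by
    refine eq_zero_of_laplacian_mem_harmonic_of_mem_orthogonal hdT hdS hcS hdom hval _ ?_ ?_
    · rw [LinearPMap.map_sub]
      have : L ⟨K₁ f, h₁⟩ - L ⟨K₂ f, h₂⟩ = (f - L ⟨K₂ f, h₂⟩) - (f - L ⟨K₁ f, h₁⟩) := by abel
      rw [this]; exact Submodule.sub_mem _ hp₂ hp₁
    · exact Submodule.sub_mem _ ho₁ ho₂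
  have := congrArg (fun z : L.domain ↦ (z : F)) hd
  simpa [sub_eq_zero] using this

/-- **`K` vanishes on `𝔥`** (for `f ∈ 𝔥`, `□Kf = f − p ∈ 𝔥` and `Kf ⊥ 𝔥`).
[cite: ArnoldFalkWinther2010, §3.2.1 (`Lu = f − P_𝔥 f`, `u ⊥ 𝔥`, with `P_𝔥 f = f`)] -/
theorem green_apply_eq_zero_of_mem_harmonic (hdT : Dense (T.domain : Set E)) (hdS : Dense (S.domain : Set F))
    (hcS : S.IsClosed)
    (hdom : ∀ x : F, x ∈ L.domain ↔ (∃ hxT : x ∈ T†.domain, T† ⟨x, hxT⟩ ∈ T.domain) ∧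
      (∃ hxS : x ∈ S.domain, S ⟨x, hxS⟩ ∈ S†.domain))
    (hval : ∀ (x : L.domain) (hxT : (x : F) ∈ T†.domain) (hTx : T† ⟨x, hxT⟩ ∈ T.domain)
      (hxS : (x : F) ∈ S.domain) (hSx : S ⟨x, hxS⟩ ∈ S†.domain),
      L x = T ⟨T† ⟨x, hxT⟩, hTx⟩ + S† ⟨S ⟨x, hxS⟩, hSx⟩)
    (hK : ∀ f : F, ∃ h : K f ∈ L.domain,
      K f ∈ ((LinearMap.ker S.toFun).map S.domain.subtype ⊓ (LinearMap.ker T†.toFun).map T†.domain.subtype)ᗮ ∧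
      f - L ⟨K f, h⟩ ∈ (LinearMap.ker S.toFun).map S.domain.subtype ⊓
        (LinearMap.ker T†.toFun).map T†.domain.subtype)
    {f : F}
    (hf : f ∈ (LinearMap.ker S.toFun).map S.domain.subtype ⊓ (LinearMap.ker T†.toFun).map T†.domain.subtype) :
    K f = 0 := by
  obtain ⟨h, ho, hp⟩ := hK f
  have hd : (⟨K f, h⟩ : L.domain) = 0 := by
    refine eq_zero_of_laplacian_mem_harmonic_of_mem_orthogonal hdT hdS hcS hdom hval _ ?_ ho
    have : L ⟨K f, h⟩ = f - (f - L ⟨K f, h⟩) := by abel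
    rw [this]; exact Submodule.sub_mem _ hf hp
  have := congrArg (fun z : L.domain ↦ (z : F)) hd
  simpa using this

/-- **`K□u = u` for `u ∈ D_□ ∩ 𝔥^⊥`** (`□(K□u − u) = −p ∈ 𝔥` and `K□u − u ⊥ 𝔥`).
[cite: ArnoldFalkWinther2010, §3.2.1] -/
theorem green_laplacian_apply (hdT : Dense (T.domain : Set E)) (hdS : Dense (S.domain : Set F))
    (hcS : S.IsClosed)
    (hdom : ∀ x : F, x ∈ L.domain ↔ (∃ hxT : x ∈ T†.domain, T† ⟨x, hxT⟩ ∈ T.domain) ∧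
      (∃ hxS : x ∈ S.domain, S ⟨x, hxS⟩ ∈ S†.domain))
    (hval : ∀ (x : L.domain) (hxT : (x : F) ∈ T†.domain) (hTx : T† ⟨x, hxT⟩ ∈ T.domain)
      (hxS : (x : F) ∈ S.domain) (hSx : S ⟨x, hxS⟩ ∈ S†.domain),
      L x = T ⟨T† ⟨x, hxT⟩, hTx⟩ + S† ⟨S ⟨x, hxS⟩, hSx⟩)
    (hK : ∀ f : F, ∃ h : K f ∈ L.domain,
      K f ∈ ((LinearMap.ker S.toFun).map S.domain.subtype ⊓ (LinearMap.ker T†.toFun).map T†.domain.subtype)ᗮ ∧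
      f - L ⟨K f, h⟩ ∈ (LinearMap.ker S.toFun).map S.domain.subtype ⊓
        (LinearMap.ker T†.toFun).map T†.domain.subtype)
    (u : L.domain) (hu : (u : F) ∈ ((LinearMap.ker S.toFun).map S.domain.subtype ⊓
      (LinearMap.ker T†.toFun).map T†.domain.subtype)ᗮ) :
    K (L u) = u := by
  obtain ⟨h, ho, hp⟩ := hK (L u)
  have hd : (⟨K (L u), h⟩ : L.domain) - u = 0 := by
    refine eq_zero_of_laplacian_mem_harmonic_of_mem_orthogonal hdT hdS hcS hdom hval _ ?_
      (Submodule.sub_mem _ ho hu)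
    rw [LinearPMap.map_sub]
    have : L ⟨K (L u), h⟩ - L u = -(L u - L ⟨K (L u), h⟩) := by abel
    rw [this]; exact Submodule.neg_mem _ hp
  have := congrArg (fun z : L.domain ↦ (z : F)) hd
  simpa [sub_eq_zero] using this

/-- **`□Kf = f − P_𝔥 f`** with `P_𝔥` the orthogonal projection onto the (closed) harmonic space.
[cite: ArnoldFalkWinther2010, §3.2.1 "`Lu = f − P_𝔥 f`"] -/
theorem laplacian_green_eq_sub_starProjection (hdT : Dense (T.domain : Set E)) (hdS : Dense (S.domain : Set F))
    (hcS : S.IsClosed)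
    (hdom : ∀ x : F, x ∈ L.domain ↔ (∃ hxT : x ∈ T†.domain, T† ⟨x, hxT⟩ ∈ T.domain) ∧
      (∃ hxS : x ∈ S.domain, S ⟨x, hxS⟩ ∈ S†.domain))
    (hval : ∀ (x : L.domain) (hxT : (x : F) ∈ T†.domain) (hTx : T† ⟨x, hxT⟩ ∈ T.domain)
      (hxS : (x : F) ∈ S.domain) (hSx : S ⟨x, hxS⟩ ∈ S†.domain),
      L x = T ⟨T† ⟨x, hxT⟩, hTx⟩ + S† ⟨S ⟨x, hxS⟩, hSx⟩)
    (hK : ∀ f : F, ∃ h : K f ∈ L.domain,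
      K f ∈ ((LinearMap.ker S.toFun).map S.domain.subtype ⊓ (LinearMap.ker T†.toFun).map T†.domain.subtype)ᗮ ∧
      f - L ⟨K f, h⟩ ∈ (LinearMap.ker S.toFun).map S.domain.subtype ⊓
        (LinearMap.ker T†.toFun).map T†.domain.subtype)
    [((LinearMap.ker S.toFun).map S.domain.subtype ⊓
      (LinearMap.ker T†.toFun).map T†.domain.subtype).HasOrthogonalProjection]
    (f : F) (h : K f ∈ L.domain) :
    L ⟨K f, h⟩ = f - ((LinearMap.ker S.toFun).map S.domain.subtype ⊓
      (LinearMap.ker T†.toFun).map T†.domain.subtype).starProjection f := by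
  obtain ⟨h', -, hp⟩ := hK f
  have hP : ((LinearMap.ker S.toFun).map S.domain.subtype ⊓
      (LinearMap.ker T†.toFun).map T†.domain.subtype).starProjection f = f - L ⟨K f, h'⟩ := by
    refine Submodule.eq_starProjection_of_mem_orthogonal hp ?_
    rw [sub_sub_cancel]
    exact range_laplacian_le_orthogonal_harmonic hdT hdS hcS hdom hval (LinearMap.mem_range_self _ _)
  rw [hP, sub_sub_cancel]

omit [CompleteSpace G] in
/-- **`(Kf, g) = (□Kf, Kg)`** (`g = □Kg + p` with `p ∈ 𝔥 ⊥ Kf`, and `□` is symmetric).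
[cite: ArnoldFalkWinther2010, §3.2.1] -/
theorem inner_green_eq_inner_laplacian_green (hdT : Dense (T.domain : Set E)) (hdS : Dense (S.domain : Set F))
    (hdom : ∀ x : F, x ∈ L.domain ↔ (∃ hxT : x ∈ T†.domain, T† ⟨x, hxT⟩ ∈ T.domain) ∧
      (∃ hxS : x ∈ S.domain, S ⟨x, hxS⟩ ∈ S†.domain))
    (hval : ∀ (x : L.domain) (hxT : (x : F) ∈ T†.domain) (hTx : T† ⟨x, hxT⟩ ∈ T.domain)
      (hxS : (x : F) ∈ S.domain) (hSx : S ⟨x, hxS⟩ ∈ S†.domain),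
      L x = T ⟨T† ⟨x, hxT⟩, hTx⟩ + S† ⟨S ⟨x, hxS⟩, hSx⟩)
    (hK : ∀ f : F, ∃ h : K f ∈ L.domain,
      K f ∈ ((LinearMap.ker S.toFun).map S.domain.subtype ⊓ (LinearMap.ker T†.toFun).map T†.domain.subtype)ᗮ ∧
      f - L ⟨K f, h⟩ ∈ (LinearMap.ker S.toFun).map S.domain.subtype ⊓
        (LinearMap.ker T†.toFun).map T†.domain.subtype)
    (f g : F) (hf : K f ∈ L.domain) (hg : K g ∈ L.domain) :
    ⟪K f, g⟫_𝕜 = ⟪L ⟨K f, hf⟩, K g⟫_𝕜 := by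
  obtain ⟨hf', hof, -⟩ := hK f
  obtain ⟨hg', -, hpg⟩ := hK g
  calc ⟪K f, g⟫_𝕜 = ⟪K f, L ⟨K g, hg⟩ + (g - L ⟨K g, hg'⟩)⟫_𝕜 := by rw [add_sub_cancel]
    _ = ⟪K f, L ⟨K g, hg⟩⟫_𝕜 := by
        rw [inner_add_right, Submodule.inner_left_of_mem_orthogonal hpg hof, add_zero]
    _ = ⟪L ⟨K f, hf⟩, K g⟫_𝕜 := (isSymmetric_laplacian hdT hdS hdom hval ⟨K f, hf⟩ ⟨K g, hg⟩).symm

omit [CompleteSpace G] in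
/-- **`K` is symmetric: `(Kf, g) = (f, Kg)`.** [cite: ArnoldFalkWinther2010, §3.2.1] -/
theorem green_symmetric (hdT : Dense (T.domain : Set E)) (hdS : Dense (S.domain : Set F))
    (hdom : ∀ x : F, x ∈ L.domain ↔ (∃ hxT : x ∈ T†.domain, T† ⟨x, hxT⟩ ∈ T.domain) ∧
      (∃ hxS : x ∈ S.domain, S ⟨x, hxS⟩ ∈ S†.domain))
    (hval : ∀ (x : L.domain) (hxT : (x : F) ∈ T†.domain) (hTx : T† ⟨x, hxT⟩ ∈ T.domain)
      (hxS : (x : F) ∈ S.domain) (hSx : S ⟨x, hxS⟩ ∈ S†.domain),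
      L x = T ⟨T† ⟨x, hxT⟩, hTx⟩ + S† ⟨S ⟨x, hxS⟩, hSx⟩)
    (hK : ∀ f : F, ∃ h : K f ∈ L.domain,
      K f ∈ ((LinearMap.ker S.toFun).map S.domain.subtype ⊓ (LinearMap.ker T†.toFun).map T†.domain.subtype)ᗮ ∧
      f - L ⟨K f, h⟩ ∈ (LinearMap.ker S.toFun).map S.domain.subtype ⊓
        (LinearMap.ker T†.toFun).map T†.domain.subtype)
    (f g : F) : ⟪K f, g⟫_𝕜 = ⟪f, K g⟫_𝕜 := by
  obtain ⟨hf, -, -⟩ := hK f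
  obtain ⟨hg, -, -⟩ := hK g
  rw [inner_green_eq_inner_laplacian_green hdT hdS hdom hval hK f g hf hg, ← inner_conj_symm f (K g),
    inner_green_eq_inner_laplacian_green hdT hdS hdom hval hK g f hg hf, inner_conj_symm]
  exact isSymmetric_laplacian hdT hdS hdom hval ⟨K f, hf⟩ ⟨K g, hg⟩

omit [CompleteSpace G] in
/-- **`Re (Kf, f) = ‖T*Kf‖² + ‖SKf‖²`** (`(Kf, f) = (□Kf, Kf)`). [cite: ArnoldFalkWinther2010, §3.2.1;
BruningLesch1992, §2 (2.13)–(2.14)] -/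
theorem re_inner_green_self_eq (hdT : Dense (T.domain : Set E)) (hdS : Dense (S.domain : Set F))
    (hdom : ∀ x : F, x ∈ L.domain ↔ (∃ hxT : x ∈ T†.domain, T† ⟨x, hxT⟩ ∈ T.domain) ∧
      (∃ hxS : x ∈ S.domain, S ⟨x, hxS⟩ ∈ S†.domain))
    (hval : ∀ (x : L.domain) (hxT : (x : F) ∈ T†.domain) (hTx : T† ⟨x, hxT⟩ ∈ T.domain)
      (hxS : (x : F) ∈ S.domain) (hSx : S ⟨x, hxS⟩ ∈ S†.domain),
      L x = T ⟨T† ⟨x, hxT⟩, hTx⟩ + S† ⟨S ⟨x, hxS⟩, hSx⟩)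
    (hK : ∀ f : F, ∃ h : K f ∈ L.domain,
      K f ∈ ((LinearMap.ker S.toFun).map S.domain.subtype ⊓ (LinearMap.ker T†.toFun).map T†.domain.subtype)ᗮ ∧
      f - L ⟨K f, h⟩ ∈ (LinearMap.ker S.toFun).map S.domain.subtype ⊓
        (LinearMap.ker T†.toFun).map T†.domain.subtype)
    (f : F) (hf : K f ∈ L.domain) :
    RCLike.re ⟪K f, f⟫_𝕜 = ‖T† ⟨K f, laplacian_domain_le_adjoint_domain hdom hf⟩‖ ^ 2 +
      ‖S ⟨K f, laplacian_domain_le_domain hdom hf⟩‖ ^ 2 := by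
  rw [inner_green_eq_inner_laplacian_green hdT hdS hdom hval hK f f hf hf]
  exact re_inner_laplacian_self hdT hdS hdom hval ⟨K f, hf⟩

omit [CompleteSpace G] in
/-- **`K` is a positive operator** (symmetric with `Re (Kf, f) = ‖T*Kf‖² + ‖SKf‖² ≥ 0`).
[cite: ArnoldFalkWinther2010, §3.2.1] -/
theorem green_isPositive (hdT : Dense (T.domain : Set E)) (hdS : Dense (S.domain : Set F))
    (hdom : ∀ x : F, x ∈ L.domain ↔ (∃ hxT : x ∈ T†.domain, T† ⟨x, hxT⟩ ∈ T.domain) ∧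
      (∃ hxS : x ∈ S.domain, S ⟨x, hxS⟩ ∈ S†.domain))
    (hval : ∀ (x : L.domain) (hxT : (x : F) ∈ T†.domain) (hTx : T† ⟨x, hxT⟩ ∈ T.domain)
      (hxS : (x : F) ∈ S.domain) (hSx : S ⟨x, hxS⟩ ∈ S†.domain),
      L x = T ⟨T† ⟨x, hxT⟩, hTx⟩ + S† ⟨S ⟨x, hxS⟩, hSx⟩)
    (hK : ∀ f : F, ∃ h : K f ∈ L.domain,
      K f ∈ ((LinearMap.ker S.toFun).map S.domain.subtype ⊓ (LinearMap.ker T†.toFun).map T†.domain.subtype)ᗮ ∧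
      f - L ⟨K f, h⟩ ∈ (LinearMap.ker S.toFun).map S.domain.subtype ⊓
        (LinearMap.ker T†.toFun).map T†.domain.subtype) :
    K.IsPositive := by
  refine ContinuousLinearMap.isPositive_def.2 ⟨fun f g ↦ green_symmetric hdT hdS hdom hval hK f g, fun f ↦ ?_⟩
  obtain ⟨hf, -, -⟩ := hK f
  rw [ContinuousLinearMap.reApplyInnerSelf_apply, re_inner_green_self_eq hdT hdS hdom hval hK f hf]
  positivity

omit [CompleteSpace G] in
/-- **`K` is self-adjoint.** [cite: ArnoldFalkWinther2010, §3.2.1] -/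
theorem isSelfAdjoint_green (hdT : Dense (T.domain : Set E)) (hdS : Dense (S.domain : Set F))
    (hdom : ∀ x : F, x ∈ L.domain ↔ (∃ hxT : x ∈ T†.domain, T† ⟨x, hxT⟩ ∈ T.domain) ∧
      (∃ hxS : x ∈ S.domain, S ⟨x, hxS⟩ ∈ S†.domain))
    (hval : ∀ (x : L.domain) (hxT : (x : F) ∈ T†.domain) (hTx : T† ⟨x, hxT⟩ ∈ T.domain)
      (hxS : (x : F) ∈ S.domain) (hSx : S ⟨x, hxS⟩ ∈ S†.domain),
      L x = T ⟨T† ⟨x, hxT⟩, hTx⟩ + S† ⟨S ⟨x, hxS⟩, hSx⟩)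
    (hK : ∀ f : F, ∃ h : K f ∈ L.domain,
      K f ∈ ((LinearMap.ker S.toFun).map S.domain.subtype ⊓ (LinearMap.ker T†.toFun).map T†.domain.subtype)ᗮ ∧
      f - L ⟨K f, h⟩ ∈ (LinearMap.ker S.toFun).map S.domain.subtype ⊓
        (LinearMap.ker T†.toFun).map T†.domain.subtype) :
    IsSelfAdjoint K :=
  (green_isPositive hdT hdS hdom hval hK).isSelfAdjoint

end Basic

/-! ### §2 The Hodge decomposition realised by `K`: `P_𝔅 = TT*K`, `P_{𝔅*} = S*SK` -/

section Projections

omit [CompleteSpace G] in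
/-- **`f = TT*Kf + S*SKf + (f − □Kf)`** — "the expression `f = dσ + p + d*du` (`σ = d*Kf`, `u = Kf`,
`p = P_𝔥 f`) is precisely the Hodge decomposition of `f`". [cite: ArnoldFalkWinther2010, §3.2.1] -/
theorem eq_laplacian_green_add
    (hval : ∀ (x : L.domain) (hxT : (x : F) ∈ T†.domain) (hTx : T† ⟨x, hxT⟩ ∈ T.domain)
      (hxS : (x : F) ∈ S.domain) (hSx : S ⟨x, hxS⟩ ∈ S†.domain),
      L x = T ⟨T† ⟨x, hxT⟩, hTx⟩ + S† ⟨S ⟨x, hxS⟩, hSx⟩)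
    (f : F) (h : K f ∈ L.domain) (hxT : K f ∈ T†.domain) (hTx : T† ⟨K f, hxT⟩ ∈ T.domain)
    (hxS : K f ∈ S.domain) (hSx : S ⟨K f, hxS⟩ ∈ S†.domain) :
    f = T ⟨T† ⟨K f, hxT⟩, hTx⟩ + S† ⟨S ⟨K f, hxS⟩, hSx⟩ + (f - L ⟨K f, h⟩) := by
  rw [hval ⟨K f, h⟩ hxT hTx hxS hSx]; abel

omit [CompleteSpace G] in
/-- **`P_𝔅 = dd*K`: `f − TT*Kf ⊥ Im T`** (while `TT*Kf ∈ Im T`), because `f − TT*Kf = S*SKf + p` with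
`p = f − □Kf ∈ 𝔥 ⊆ Ker T* = (Im T)^⊥` and `S*SKf ∈ Im S* ⊆ Ker T*`. [cite: ArnoldFalkWinther2010, §3.2.1 "`P_𝔅 = dd*K`"] -/
theorem sub_adjoint_green_mem_orthogonal_range (hdT : Dense (T.domain : Set E)) (hdS : Dense (S.domain : Set F))
    (hST : LinearMap.range T.toFun ≤ (LinearMap.ker S.toFun).map S.domain.subtype)
    (hdom : ∀ x : F, x ∈ L.domain ↔ (∃ hxT : x ∈ T†.domain, T† ⟨x, hxT⟩ ∈ T.domain) ∧
      (∃ hxS : x ∈ S.domain, S ⟨x, hxS⟩ ∈ S†.domain))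
    (hval : ∀ (x : L.domain) (hxT : (x : F) ∈ T†.domain) (hTx : T† ⟨x, hxT⟩ ∈ T.domain)
      (hxS : (x : F) ∈ S.domain) (hSx : S ⟨x, hxS⟩ ∈ S†.domain),
      L x = T ⟨T† ⟨x, hxT⟩, hTx⟩ + S† ⟨S ⟨x, hxS⟩, hSx⟩)
    (hK : ∀ f : F, ∃ h : K f ∈ L.domain,
      K f ∈ ((LinearMap.ker S.toFun).map S.domain.subtype ⊓ (LinearMap.ker T†.toFun).map T†.domain.subtype)ᗮ ∧
      f - L ⟨K f, h⟩ ∈ (LinearMap.ker S.toFun).map S.domain.subtype ⊓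
        (LinearMap.ker T†.toFun).map T†.domain.subtype)
    (f : F) (hxT : K f ∈ T†.domain) (hTx : T† ⟨K f, hxT⟩ ∈ T.domain) :
    f - T ⟨T† ⟨K f, hxT⟩, hTx⟩ ∈ (LinearMap.range T.toFun)ᗮ := by
  obtain ⟨h, -, hp⟩ := hK f
  obtain ⟨-, hxS, hSx⟩ := (hdom (K f)).1 h
  have hsplit : f - T ⟨T† ⟨K f, hxT⟩, hTx⟩ = S† ⟨S ⟨K f, hxS⟩, hSx⟩ + (f - L ⟨K f, h⟩) := by
    rw [hval ⟨K f, h⟩ hxT hTx hxS hSx]; abel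
  rw [hsplit, orthogonal_range_eq_ker_adjoint hdT]
  refine Submodule.add_mem _ (range_adjoint_le_pmapKer_adjoint hdS hST (LinearMap.mem_range_self _ _)) ?_
  exact (Submodule.mem_inf.1 hp).2

omit [CompleteSpace G] in
/-- **`P_𝔅 = dd*K` as an identity of operators**: the orthogonal projection of `f` onto the closed subspace
`cl Im T` (`= Im T` for a closed complex) is `TT*Kf`. [cite: ArnoldFalkWinther2010, §3.2.1 "`P_𝔅 = dd*K`"] -/
theorem starProjection_closure_range_eq (hdT : Dense (T.domain : Set E)) (hdS : Dense (S.domain : Set F))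
    (hST : LinearMap.range T.toFun ≤ (LinearMap.ker S.toFun).map S.domain.subtype)
    (hdom : ∀ x : F, x ∈ L.domain ↔ (∃ hxT : x ∈ T†.domain, T† ⟨x, hxT⟩ ∈ T.domain) ∧
      (∃ hxS : x ∈ S.domain, S ⟨x, hxS⟩ ∈ S†.domain))
    (hval : ∀ (x : L.domain) (hxT : (x : F) ∈ T†.domain) (hTx : T† ⟨x, hxT⟩ ∈ T.domain)
      (hxS : (x : F) ∈ S.domain) (hSx : S ⟨x, hxS⟩ ∈ S†.domain),
      L x = T ⟨T† ⟨x, hxT⟩, hTx⟩ + S† ⟨S ⟨x, hxS⟩, hSx⟩)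
    (hK : ∀ f : F, ∃ h : K f ∈ L.domain,
      K f ∈ ((LinearMap.ker S.toFun).map S.domain.subtype ⊓ (LinearMap.ker T†.toFun).map T†.domain.subtype)ᗮ ∧
      f - L ⟨K f, h⟩ ∈ (LinearMap.ker S.toFun).map S.domain.subtype ⊓
        (LinearMap.ker T†.toFun).map T†.domain.subtype)
    (f : F) (hxT : K f ∈ T†.domain) (hTx : T† ⟨K f, hxT⟩ ∈ T.domain) :
    (LinearMap.range T.toFun).topologicalClosure.starProjection f = T ⟨T† ⟨K f, hxT⟩, hTx⟩ := by
  refine Submodule.eq_starProjection_of_mem_orthogonal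
    (Submodule.le_topologicalClosure _ (LinearMap.mem_range_self _ _)) ?_
  rw [Submodule.orthogonal_closure]
  exact sub_adjoint_green_mem_orthogonal_range hdT hdS hST hdom hval hK f hxT hTx

/-- **`P_{𝔅*} = d*dK`: `f − S*SKf ⊥ Im S*`** (while `S*SKf ∈ Im S*`), because `f − S*SKf = TT*Kf + p` lies in
`Im T + 𝔥 ⊆ Ker S = (Im S*)^⊥`. [cite: ArnoldFalkWinther2010, §3.2.1 "`P_{𝔅*} = d*dK`"] -/
theorem sub_apply_green_mem_orthogonal_range_adjoint (hdS : Dense (S.domain : Set F)) (hcS : S.IsClosed)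
    (hST : LinearMap.range T.toFun ≤ (LinearMap.ker S.toFun).map S.domain.subtype)
    (hdom : ∀ x : F, x ∈ L.domain ↔ (∃ hxT : x ∈ T†.domain, T† ⟨x, hxT⟩ ∈ T.domain) ∧
      (∃ hxS : x ∈ S.domain, S ⟨x, hxS⟩ ∈ S†.domain))
    (hval : ∀ (x : L.domain) (hxT : (x : F) ∈ T†.domain) (hTx : T† ⟨x, hxT⟩ ∈ T.domain)
      (hxS : (x : F) ∈ S.domain) (hSx : S ⟨x, hxS⟩ ∈ S†.domain),
      L x = T ⟨T† ⟨x, hxT⟩, hTx⟩ + S† ⟨S ⟨x, hxS⟩, hSx⟩)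
    (hK : ∀ f : F, ∃ h : K f ∈ L.domain,
      K f ∈ ((LinearMap.ker S.toFun).map S.domain.subtype ⊓ (LinearMap.ker T†.toFun).map T†.domain.subtype)ᗮ ∧
      f - L ⟨K f, h⟩ ∈ (LinearMap.ker S.toFun).map S.domain.subtype ⊓
        (LinearMap.ker T†.toFun).map T†.domain.subtype)
    (f : F) (hxS : K f ∈ S.domain) (hSx : S ⟨K f, hxS⟩ ∈ S†.domain) :
    f - S† ⟨S ⟨K f, hxS⟩, hSx⟩ ∈ (LinearMap.range S†.toFun)ᗮ := by
  obtain ⟨h, -, hp⟩ := hK f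
  obtain ⟨⟨hxT, hTx⟩, -⟩ := (hdom (K f)).1 h
  have hsplit : f - S† ⟨S ⟨K f, hxS⟩, hSx⟩ = T ⟨T† ⟨K f, hxT⟩, hTx⟩ + (f - L ⟨K f, h⟩) := by
    rw [hval ⟨K f, h⟩ hxT hTx hxS hSx]; abel
  rw [hsplit]
  have hle : (LinearMap.ker S.toFun).map S.domain.subtype ≤ (LinearMap.range S†.toFun)ᗮ :=
    (isOrtho_ker_closure_range_adjoint hdS hcS).mono_right (Submodule.le_topologicalClosure _)
  exact hle (Submodule.add_mem _ (hST (LinearMap.mem_range_self _ _)) (Submodule.mem_inf.1 hp).1)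

/-- **`P_{𝔅*} = d*dK` as an identity of operators**: the orthogonal projection of `f` onto `cl Im S*` (`= Im S*`
for a closed complex) is `S*SKf`. [cite: ArnoldFalkWinther2010, §3.2.1 "`P_{𝔅*} = d*dK`"] -/
theorem starProjection_closure_range_adjoint_eq (hdS : Dense (S.domain : Set F)) (hcS : S.IsClosed)
    (hST : LinearMap.range T.toFun ≤ (LinearMap.ker S.toFun).map S.domain.subtype)
    (hdom : ∀ x : F, x ∈ L.domain ↔ (∃ hxT : x ∈ T†.domain, T† ⟨x, hxT⟩ ∈ T.domain) ∧
      (∃ hxS : x ∈ S.domain, S ⟨x, hxS⟩ ∈ S†.domain))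
    (hval : ∀ (x : L.domain) (hxT : (x : F) ∈ T†.domain) (hTx : T† ⟨x, hxT⟩ ∈ T.domain)
      (hxS : (x : F) ∈ S.domain) (hSx : S ⟨x, hxS⟩ ∈ S†.domain),
      L x = T ⟨T† ⟨x, hxT⟩, hTx⟩ + S† ⟨S ⟨x, hxS⟩, hSx⟩)
    (hK : ∀ f : F, ∃ h : K f ∈ L.domain,
      K f ∈ ((LinearMap.ker S.toFun).map S.domain.subtype ⊓ (LinearMap.ker T†.toFun).map T†.domain.subtype)ᗮ ∧
      f - L ⟨K f, h⟩ ∈ (LinearMap.ker S.toFun).map S.domain.subtype ⊓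
        (LinearMap.ker T†.toFun).map T†.domain.subtype)
    (f : F) (hxS : K f ∈ S.domain) (hSx : S ⟨K f, hxS⟩ ∈ S†.domain) :
    (LinearMap.range S†.toFun).topologicalClosure.starProjection f = S† ⟨S ⟨K f, hxS⟩, hSx⟩ := by
  refine Submodule.eq_starProjection_of_mem_orthogonal
    (Submodule.le_topologicalClosure _ (LinearMap.mem_range_self _ _)) ?_
  rw [Submodule.orthogonal_closure]
  exact sub_apply_green_mem_orthogonal_range_adjoint hdS hcS hST hdom hval hK f hxS hSx

end Projections

/-! ### §3 `K` commutes with the differentials: `dK = Kd`, `d*K = Kd*` -/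

section CommuteNext

variable {H : Type*} [NormedAddCommGroup H] [InnerProductSpace 𝕜 H] [CompleteSpace H]
variable {U : G →ₗ.[𝕜] H} {L' : G →ₗ.[𝕜] G} {K' : G →L[𝕜] G}

omit [CompleteSpace H] in
/-- **"This shows that `du ∈ D_L`. Clearly `Ldu = dd*du = d(dd* + d*d)u = dLu = df`"**: for `f ∈ D_S` and
`u = Kf`, the element `Su` lies in the domain of the next Laplacian `□′ = SS* + U*U` (of `F →S G →U H`), with
`□′(Su) = Sf`, and `Su ⊥ 𝔥′ = Ker U ∩ Ker S*` (`Su ∈ Im S ⊥ Ker S*`). [cite: ArnoldFalkWinther2010, §3.2.1] -/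
theorem laplacian_next_apply_green (hdS : Dense (S.domain : Set F))
    (hST : LinearMap.range T.toFun ≤ (LinearMap.ker S.toFun).map S.domain.subtype)
    (hSU : LinearMap.range S.toFun ≤ (LinearMap.ker U.toFun).map U.domain.subtype)
    (hdom : ∀ x : F, x ∈ L.domain ↔ (∃ hxT : x ∈ T†.domain, T† ⟨x, hxT⟩ ∈ T.domain) ∧
      (∃ hxS : x ∈ S.domain, S ⟨x, hxS⟩ ∈ S†.domain))
    (hval : ∀ (x : L.domain) (hxT : (x : F) ∈ T†.domain) (hTx : T† ⟨x, hxT⟩ ∈ T.domain)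
      (hxS : (x : F) ∈ S.domain) (hSx : S ⟨x, hxS⟩ ∈ S†.domain),
      L x = T ⟨T† ⟨x, hxT⟩, hTx⟩ + S† ⟨S ⟨x, hxS⟩, hSx⟩)
    (hK : ∀ f : F, ∃ h : K f ∈ L.domain,
      K f ∈ ((LinearMap.ker S.toFun).map S.domain.subtype ⊓ (LinearMap.ker T†.toFun).map T†.domain.subtype)ᗮ ∧
      f - L ⟨K f, h⟩ ∈ (LinearMap.ker S.toFun).map S.domain.subtype ⊓
        (LinearMap.ker T†.toFun).map T†.domain.subtype)
    (hdom' : ∀ y : G, y ∈ L'.domain ↔ (∃ hyS : y ∈ S†.domain, S† ⟨y, hyS⟩ ∈ S.domain) ∧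
      (∃ hyU : y ∈ U.domain, U ⟨y, hyU⟩ ∈ U†.domain))
    (hval' : ∀ (y : L'.domain) (hyS : (y : G) ∈ S†.domain) (hSy : S† ⟨y, hyS⟩ ∈ S.domain)
      (hyU : (y : G) ∈ U.domain) (hUy : U ⟨y, hyU⟩ ∈ U†.domain),
      L' y = S ⟨S† ⟨y, hyS⟩, hSy⟩ + U† ⟨U ⟨y, hyU⟩, hUy⟩)
    (f : F) (hf : f ∈ S.domain) (hKS : K f ∈ S.domain) :
    ∃ hw : S ⟨K f, hKS⟩ ∈ L'.domain, L' ⟨S ⟨K f, hKS⟩, hw⟩ = S ⟨f, hf⟩ ∧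
      S ⟨K f, hKS⟩ ∈ ((LinearMap.ker U.toFun).map U.domain.subtype ⊓
        (LinearMap.ker S†.toFun).map S†.domain.subtype)ᗮ := by
  obtain ⟨h, -, hp⟩ := hK f
  obtain ⟨⟨hxT, hTx⟩, ⟨hxS', hSx⟩⟩ := (hdom (K f)).1 h
  -- `S*Su = f − p − TT*u ∈ D_S` with `S(S*Su) = Sf`
  have hpS : f - L ⟨K f, h⟩ ∈ (LinearMap.ker S.toFun).map S.domain.subtype := (Submodule.mem_inf.1 hp).1
  obtain ⟨hpdom, hSp⟩ := mem_pmapKer_iff.1 hpS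
  obtain ⟨htdom, hSt⟩ := mem_pmapKer_iff.1 (hST (LinearMap.mem_range_self T.toFun ⟨T† ⟨K f, hxT⟩, hTx⟩))
  have heq : S† ⟨S ⟨K f, hKS⟩, hSx⟩ = f - (f - L ⟨K f, h⟩) - T ⟨T† ⟨K f, hxT⟩, hTx⟩ := by
    rw [hval ⟨K f, h⟩ hxT hTx hKS hSx]; abel
  have hSdom : S† ⟨S ⟨K f, hKS⟩, hSx⟩ ∈ S.domain := by
    rw [heq]; exact S.domain.sub_mem (S.domain.sub_mem hf hpdom) htdom
  have hSS : S ⟨S† ⟨S ⟨K f, hKS⟩, hSx⟩, hSdom⟩ = S ⟨f, hf⟩ := by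
    have e : (⟨S† ⟨S ⟨K f, hKS⟩, hSx⟩, hSdom⟩ : S.domain) =
        ⟨f, hf⟩ - ⟨f - L ⟨K f, h⟩, hpdom⟩ - ⟨T ⟨T† ⟨K f, hxT⟩, hTx⟩, htdom⟩ :=
      Subtype.ext (by simp only [Submodule.coe_sub]; exact heq)
    rw [e, LinearPMap.map_sub, LinearPMap.map_sub, hSp, sub_zero]
    exact sub_eq_self.2 hSt
  -- `Su ∈ Im S ⊆ Ker U`
  have hwrange : S ⟨K f, hKS⟩ ∈ LinearMap.range S.toFun := LinearMap.mem_range_self S.toFun ⟨K f, hKS⟩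
  obtain ⟨hwU, hUw⟩ := mem_pmapKer_iff.1 (hSU hwrange)
  have hUwdom : U ⟨S ⟨K f, hKS⟩, hwU⟩ ∈ U†.domain := by rw [hUw]; exact U†.domain.zero_mem
  have hw : S ⟨K f, hKS⟩ ∈ L'.domain := (hdom' _).2 ⟨⟨hSx, hSdom⟩, ⟨hwU, hUwdom⟩⟩
  refine ⟨hw, ?_, ?_⟩
  · have e0 : (⟨U ⟨S ⟨K f, hKS⟩, hwU⟩, hUwdom⟩ : U†.domain) = 0 := Subtype.ext hUw
    rw [hval' ⟨S ⟨K f, hKS⟩, hw⟩ hSx hSdom hwU hUwdom, hSS, e0, LinearPMap.map_zero, add_zero]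
  · refine (Submodule.mem_orthogonal _ _).2 fun q hq ↦ ?_
    have hq' : q ∈ (LinearMap.range S.toFun)ᗮ := by
      rw [orthogonal_range_eq_ker_adjoint hdS]; exact (Submodule.mem_inf.1 hq).2
    exact Submodule.inner_left_of_mem_orthogonal hwrange hq'

/-- **`dKf = Kdf` for `f ∈ V^k`**: `S(Kf) = K′(Sf)` for `f ∈ D_S`, where `K′` is a Green operator of the next
Laplacian `□′ = SS* + U*U` (both sides solve `□′u = Sf`, `u ⊥ 𝔥′`). [cite: ArnoldFalkWinther2010, §3.2.1 "`dKf = Kdf`"] -/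
theorem apply_green_eq_green_apply (hdS : Dense (S.domain : Set F)) (hdU : Dense (U.domain : Set G))
    (hcU : U.IsClosed)
    (hST : LinearMap.range T.toFun ≤ (LinearMap.ker S.toFun).map S.domain.subtype)
    (hSU : LinearMap.range S.toFun ≤ (LinearMap.ker U.toFun).map U.domain.subtype)
    (hdom : ∀ x : F, x ∈ L.domain ↔ (∃ hxT : x ∈ T†.domain, T† ⟨x, hxT⟩ ∈ T.domain) ∧
      (∃ hxS : x ∈ S.domain, S ⟨x, hxS⟩ ∈ S†.domain))
    (hval : ∀ (x : L.domain) (hxT : (x : F) ∈ T†.domain) (hTx : T† ⟨x, hxT⟩ ∈ T.domain)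
      (hxS : (x : F) ∈ S.domain) (hSx : S ⟨x, hxS⟩ ∈ S†.domain),
      L x = T ⟨T† ⟨x, hxT⟩, hTx⟩ + S† ⟨S ⟨x, hxS⟩, hSx⟩)
    (hK : ∀ f : F, ∃ h : K f ∈ L.domain,
      K f ∈ ((LinearMap.ker S.toFun).map S.domain.subtype ⊓ (LinearMap.ker T†.toFun).map T†.domain.subtype)ᗮ ∧
      f - L ⟨K f, h⟩ ∈ (LinearMap.ker S.toFun).map S.domain.subtype ⊓
        (LinearMap.ker T†.toFun).map T†.domain.subtype)
    (hdom' : ∀ y : G, y ∈ L'.domain ↔ (∃ hyS : y ∈ S†.domain, S† ⟨y, hyS⟩ ∈ S.domain) ∧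
      (∃ hyU : y ∈ U.domain, U ⟨y, hyU⟩ ∈ U†.domain))
    (hval' : ∀ (y : L'.domain) (hyS : (y : G) ∈ S†.domain) (hSy : S† ⟨y, hyS⟩ ∈ S.domain)
      (hyU : (y : G) ∈ U.domain) (hUy : U ⟨y, hyU⟩ ∈ U†.domain),
      L' y = S ⟨S† ⟨y, hyS⟩, hSy⟩ + U† ⟨U ⟨y, hyU⟩, hUy⟩)
    (hK' : ∀ g : G, ∃ h : K' g ∈ L'.domain,
      K' g ∈ ((LinearMap.ker U.toFun).map U.domain.subtype ⊓ (LinearMap.ker S†.toFun).map S†.domain.subtype)ᗮ ∧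
      g - L' ⟨K' g, h⟩ ∈ (LinearMap.ker U.toFun).map U.domain.subtype ⊓
        (LinearMap.ker S†.toFun).map S†.domain.subtype)
    (f : F) (hf : f ∈ S.domain) (hKS : K f ∈ S.domain) :
    S ⟨K f, hKS⟩ = K' (S ⟨f, hf⟩) := by
  obtain ⟨hw, hL'w, hwo⟩ := laplacian_next_apply_green hdS hST hSU hdom hval hK hdom' hval' f hf hKS
  obtain ⟨hv, hvo, hvp⟩ := hK' (S ⟨f, hf⟩)
  have hd : (⟨S ⟨K f, hKS⟩, hw⟩ : L'.domain) - ⟨K' (S ⟨f, hf⟩), hv⟩ = 0 := by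
    refine eq_zero_of_laplacian_mem_harmonic_of_mem_orthogonal (T := S) (S := U) (L := L') hdS hdU hcU
      hdom' hval' _ ?_ (Submodule.sub_mem _ hwo hvo)
    rw [LinearPMap.map_sub, hL'w]; exact hvp
  have := congrArg (fun z : L'.domain ↦ (z : G)) hd
  simpa [sub_eq_zero] using this

end CommuteNext

section CommutePrev

variable {D : Type*} [NormedAddCommGroup D] [InnerProductSpace 𝕜 D] [CompleteSpace D]
variable {R : D →ₗ.[𝕜] E} {L₀ : E →ₗ.[𝕜] E} {K₀ : E →L[𝕜] E}

omit [CompleteSpace G] in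
/-- The dual computation: for `g ∈ D_{T*}` and `u = Kg`, `T*u` lies in the domain of the previous Laplacian
`□₀ = RR* + T*T` (of `D →R E →T F`) with `□₀(T*u) = T*g`, and `T*u ⊥ 𝔥₀ = Ker T ∩ Ker R*` (`T*u ∈ Im T* ⊥ Ker T`).
[cite: ArnoldFalkWinther2010, §3.2.1 ("`d*Kg = Kd*g`, `g ∈ V*_k`")] -/
theorem laplacian_prev_adjoint_green (hdT : Dense (T.domain : Set E)) (hcT : T.IsClosed)
    (hdS : Dense (S.domain : Set F))
    (hRT : LinearMap.range R.toFun ≤ (LinearMap.ker T.toFun).map T.domain.subtype)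
    (hST : LinearMap.range T.toFun ≤ (LinearMap.ker S.toFun).map S.domain.subtype)
    (hdom : ∀ x : F, x ∈ L.domain ↔ (∃ hxT : x ∈ T†.domain, T† ⟨x, hxT⟩ ∈ T.domain) ∧
      (∃ hxS : x ∈ S.domain, S ⟨x, hxS⟩ ∈ S†.domain))
    (hval : ∀ (x : L.domain) (hxT : (x : F) ∈ T†.domain) (hTx : T† ⟨x, hxT⟩ ∈ T.domain)
      (hxS : (x : F) ∈ S.domain) (hSx : S ⟨x, hxS⟩ ∈ S†.domain),
      L x = T ⟨T† ⟨x, hxT⟩, hTx⟩ + S† ⟨S ⟨x, hxS⟩, hSx⟩)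
    (hK : ∀ f : F, ∃ h : K f ∈ L.domain,
      K f ∈ ((LinearMap.ker S.toFun).map S.domain.subtype ⊓ (LinearMap.ker T†.toFun).map T†.domain.subtype)ᗮ ∧
      f - L ⟨K f, h⟩ ∈ (LinearMap.ker S.toFun).map S.domain.subtype ⊓
        (LinearMap.ker T†.toFun).map T†.domain.subtype)
    (hdom₀ : ∀ z : E, z ∈ L₀.domain ↔ (∃ hzR : z ∈ R†.domain, R† ⟨z, hzR⟩ ∈ R.domain) ∧
      (∃ hzT : z ∈ T.domain, T ⟨z, hzT⟩ ∈ T†.domain))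
    (hval₀ : ∀ (z : L₀.domain) (hzR : (z : E) ∈ R†.domain) (hRz : R† ⟨z, hzR⟩ ∈ R.domain)
      (hzT : (z : E) ∈ T.domain) (hTz : T ⟨z, hzT⟩ ∈ T†.domain),
      L₀ z = R ⟨R† ⟨z, hzR⟩, hRz⟩ + T† ⟨T ⟨z, hzT⟩, hTz⟩)
    (g : F) (hg : g ∈ T†.domain) (hKT : K g ∈ T†.domain) :
    ∃ hw : T† ⟨K g, hKT⟩ ∈ L₀.domain, L₀ ⟨T† ⟨K g, hKT⟩, hw⟩ = T† ⟨g, hg⟩ ∧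
      T† ⟨K g, hKT⟩ ∈ ((LinearMap.ker T.toFun).map T.domain.subtype ⊓
        (LinearMap.ker R†.toFun).map R†.domain.subtype)ᗮ := by
  obtain ⟨h, -, hp⟩ := hK g
  obtain ⟨⟨hxT', hTx⟩, ⟨hxS, hSx⟩⟩ := (hdom (K g)).1 h
  -- `TT*u = g − p − S*Su ∈ D_{T*}` with `T*(TT*u) = T*g`
  have hpT : g - L ⟨K g, h⟩ ∈ (LinearMap.ker T†.toFun).map T†.domain.subtype := (Submodule.mem_inf.1 hp).2
  obtain ⟨hpdom, hTp⟩ := mem_pmapKer_iff.1 hpT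
  obtain ⟨hsdom, hTs⟩ := mem_pmapKer_iff.1
    (range_adjoint_le_pmapKer_adjoint hdS hST (LinearMap.mem_range_self S†.toFun ⟨S ⟨K g, hxS⟩, hSx⟩))
  have heq : T ⟨T† ⟨K g, hKT⟩, hTx⟩ = g - (g - L ⟨K g, h⟩) - S† ⟨S ⟨K g, hxS⟩, hSx⟩ := by
    rw [hval ⟨K g, h⟩ hKT hTx hxS hSx]; abel
  have hTdom : T ⟨T† ⟨K g, hKT⟩, hTx⟩ ∈ T†.domain := by
    rw [heq]; exact T†.domain.sub_mem (T†.domain.sub_mem hg hpdom) hsdom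
  have hTT : T† ⟨T ⟨T† ⟨K g, hKT⟩, hTx⟩, hTdom⟩ = T† ⟨g, hg⟩ := by
    have e : (⟨T ⟨T† ⟨K g, hKT⟩, hTx⟩, hTdom⟩ : T†.domain) =
        ⟨g, hg⟩ - ⟨g - L ⟨K g, h⟩, hpdom⟩ - ⟨S† ⟨S ⟨K g, hxS⟩, hSx⟩, hsdom⟩ :=
      Subtype.ext (by simp only [Submodule.coe_sub]; exact heq)
    rw [e, LinearPMap.map_sub, LinearPMap.map_sub, hTp, sub_zero]
    exact sub_eq_self.2 hTs
  -- `T*u ∈ Im T* ⊆ Ker R*`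
  have hwrange : T† ⟨K g, hKT⟩ ∈ LinearMap.range T†.toFun := LinearMap.mem_range_self T†.toFun ⟨K g, hKT⟩
  obtain ⟨hwR, hRw⟩ := mem_pmapKer_iff.1 (range_adjoint_le_pmapKer_adjoint hdT hRT hwrange)
  have hRwdom : R† ⟨T† ⟨K g, hKT⟩, hwR⟩ ∈ R.domain := by rw [hRw]; exact R.domain.zero_mem
  have hw : T† ⟨K g, hKT⟩ ∈ L₀.domain := (hdom₀ _).2 ⟨⟨hwR, hRwdom⟩, ⟨hTx, hTdom⟩⟩
  refine ⟨hw, ?_, ?_⟩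
  · have e0 : (⟨R† ⟨T† ⟨K g, hKT⟩, hwR⟩, hRwdom⟩ : R.domain) = 0 := Subtype.ext hRw
    rw [hval₀ ⟨T† ⟨K g, hKT⟩, hw⟩ hwR hRwdom hTx hTdom, hTT, e0, LinearPMap.map_zero, zero_add]
  · refine (Submodule.mem_orthogonal _ _).2 fun q hq ↦ ?_
    exact (isOrtho_ker_closure_range_adjoint hdT hcT).inner_eq (Submodule.mem_inf.1 hq).1
      (Submodule.le_topologicalClosure _ hwrange)

omit [CompleteSpace G] in
/-- **`d*Kg = Kd*g` for `g ∈ V*_k`**: `T*(Kg) = K₀(T*g)` for `g ∈ D_{T*}`, where `K₀` is a Green operator of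
the previous Laplacian `□₀ = RR* + T*T`. [cite: ArnoldFalkWinther2010, §3.2.1 "`d*Kg = Kd*g`"] -/
theorem adjoint_green_eq_green_adjoint (hdR : Dense (R.domain : Set D)) (hdT : Dense (T.domain : Set E))
    (hcT : T.IsClosed) (hdS : Dense (S.domain : Set F))
    (hRT : LinearMap.range R.toFun ≤ (LinearMap.ker T.toFun).map T.domain.subtype)
    (hST : LinearMap.range T.toFun ≤ (LinearMap.ker S.toFun).map S.domain.subtype)
    (hdom : ∀ x : F, x ∈ L.domain ↔ (∃ hxT : x ∈ T†.domain, T† ⟨x, hxT⟩ ∈ T.domain) ∧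
      (∃ hxS : x ∈ S.domain, S ⟨x, hxS⟩ ∈ S†.domain))
    (hval : ∀ (x : L.domain) (hxT : (x : F) ∈ T†.domain) (hTx : T† ⟨x, hxT⟩ ∈ T.domain)
      (hxS : (x : F) ∈ S.domain) (hSx : S ⟨x, hxS⟩ ∈ S†.domain),
      L x = T ⟨T† ⟨x, hxT⟩, hTx⟩ + S† ⟨S ⟨x, hxS⟩, hSx⟩)
    (hK : ∀ f : F, ∃ h : K f ∈ L.domain,
      K f ∈ ((LinearMap.ker S.toFun).map S.domain.subtype ⊓ (LinearMap.ker T†.toFun).map T†.domain.subtype)ᗮ ∧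
      f - L ⟨K f, h⟩ ∈ (LinearMap.ker S.toFun).map S.domain.subtype ⊓
        (LinearMap.ker T†.toFun).map T†.domain.subtype)
    (hdom₀ : ∀ z : E, z ∈ L₀.domain ↔ (∃ hzR : z ∈ R†.domain, R† ⟨z, hzR⟩ ∈ R.domain) ∧
      (∃ hzT : z ∈ T.domain, T ⟨z, hzT⟩ ∈ T†.domain))
    (hval₀ : ∀ (z : L₀.domain) (hzR : (z : E) ∈ R†.domain) (hRz : R† ⟨z, hzR⟩ ∈ R.domain)
      (hzT : (z : E) ∈ T.domain) (hTz : T ⟨z, hzT⟩ ∈ T†.domain),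
      L₀ z = R ⟨R† ⟨z, hzR⟩, hRz⟩ + T† ⟨T ⟨z, hzT⟩, hTz⟩)
    (hK₀ : ∀ e : E, ∃ h : K₀ e ∈ L₀.domain,
      K₀ e ∈ ((LinearMap.ker T.toFun).map T.domain.subtype ⊓ (LinearMap.ker R†.toFun).map R†.domain.subtype)ᗮ ∧
      e - L₀ ⟨K₀ e, h⟩ ∈ (LinearMap.ker T.toFun).map T.domain.subtype ⊓
        (LinearMap.ker R†.toFun).map R†.domain.subtype)
    (g : F) (hg : g ∈ T†.domain) (hKT : K g ∈ T†.domain) :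
    T† ⟨K g, hKT⟩ = K₀ (T† ⟨g, hg⟩) := by
  obtain ⟨hw, hL₀w, hwo⟩ := laplacian_prev_adjoint_green hdT hcT hdS hRT hST hdom hval hK hdom₀ hval₀ g hg hKT
  obtain ⟨hv, hvo, hvp⟩ := hK₀ (T† ⟨g, hg⟩)
  have hd : (⟨T† ⟨K g, hKT⟩, hw⟩ : L₀.domain) - ⟨K₀ (T† ⟨g, hg⟩), hv⟩ = 0 := by
    refine eq_zero_of_laplacian_mem_harmonic_of_mem_orthogonal (T := R) (S := T) (L := L₀) hdR hdT hcT
      hdom₀ hval₀ _ ?_ (Submodule.sub_mem _ hwo hvo)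
    rw [LinearPMap.map_sub, hL₀w]; exact hvp
  have := congrArg (fun z : L₀.domain ↦ (z : E)) hd
  simpa [sub_eq_zero] using this

end CommutePrev

/-! ### §4 Bounds from the basic estimate (1.1.4): `‖K‖ ≤ C²`, `‖T*Kf‖, ‖SKf‖ ≤ |C|‖f‖` -/

section Bounds

omit [CompleteSpace G] in
/-- `‖T*Kf‖² + ‖SKf‖² ≤ ‖Kf‖ ‖f‖` (`= Re (Kf, f) ≤ ‖Kf‖‖f‖`). [cite: ArnoldFalkWinther2010, §3.2.1 / Thm 3.1] -/
theorem norm_sq_add_norm_sq_green_le (hdT : Dense (T.domain : Set E)) (hdS : Dense (S.domain : Set F))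
    (hdom : ∀ x : F, x ∈ L.domain ↔ (∃ hxT : x ∈ T†.domain, T† ⟨x, hxT⟩ ∈ T.domain) ∧
      (∃ hxS : x ∈ S.domain, S ⟨x, hxS⟩ ∈ S†.domain))
    (hval : ∀ (x : L.domain) (hxT : (x : F) ∈ T†.domain) (hTx : T† ⟨x, hxT⟩ ∈ T.domain)
      (hxS : (x : F) ∈ S.domain) (hSx : S ⟨x, hxS⟩ ∈ S†.domain),
      L x = T ⟨T† ⟨x, hxT⟩, hTx⟩ + S† ⟨S ⟨x, hxS⟩, hSx⟩)
    (hK : ∀ f : F, ∃ h : K f ∈ L.domain,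
      K f ∈ ((LinearMap.ker S.toFun).map S.domain.subtype ⊓ (LinearMap.ker T†.toFun).map T†.domain.subtype)ᗮ ∧
      f - L ⟨K f, h⟩ ∈ (LinearMap.ker S.toFun).map S.domain.subtype ⊓
        (LinearMap.ker T†.toFun).map T†.domain.subtype)
    (f : F) (hf : K f ∈ L.domain) :
    ‖T† ⟨K f, laplacian_domain_le_adjoint_domain hdom hf⟩‖ ^ 2 +
      ‖S ⟨K f, laplacian_domain_le_domain hdom hf⟩‖ ^ 2 ≤ ‖K f‖ * ‖f‖ := by
  rw [← re_inner_green_self_eq hdT hdS hdom hval hK f hf]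
  exact re_inner_le_norm (K f) f

omit [CompleteSpace G] in
/-- **`‖Kf‖ ≤ C²‖f‖` under the basic estimate (1.1.4)** (`‖u‖² ≤ C²(‖T*u‖² + ‖Su‖²) = C² Re (u, f) ≤ C²‖u‖‖f‖`
for `u = Kf ⊥ 𝔥`). [cite: Hormander1965, §1.1 Thm 1.1.2 (1.1.4); ArnoldFalkWinther2010, Thm 3.1 ("`c` depending
only on the Poincaré constant")] -/
theorem norm_green_le_of_basic_estimate (hdT : Dense (T.domain : Set E)) (hdS : Dense (S.domain : Set F))
    (hdom : ∀ x : F, x ∈ L.domain ↔ (∃ hxT : x ∈ T†.domain, T† ⟨x, hxT⟩ ∈ T.domain) ∧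
      (∃ hxS : x ∈ S.domain, S ⟨x, hxS⟩ ∈ S†.domain))
    (hval : ∀ (x : L.domain) (hxT : (x : F) ∈ T†.domain) (hTx : T† ⟨x, hxT⟩ ∈ T.domain)
      (hxS : (x : F) ∈ S.domain) (hSx : S ⟨x, hxS⟩ ∈ S†.domain),
      L x = T ⟨T† ⟨x, hxT⟩, hTx⟩ + S† ⟨S ⟨x, hxS⟩, hSx⟩)
    (hK : ∀ f : F, ∃ h : K f ∈ L.domain,
      K f ∈ ((LinearMap.ker S.toFun).map S.domain.subtype ⊓ (LinearMap.ker T†.toFun).map T†.domain.subtype)ᗮ ∧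
      f - L ⟨K f, h⟩ ∈ (LinearMap.ker S.toFun).map S.domain.subtype ⊓
        (LinearMap.ker T†.toFun).map T†.domain.subtype)
    {C : ℝ}
    (h14 : ∀ (g : F) (hgT : g ∈ T†.domain) (hgS : g ∈ S.domain),
      g ∈ ((LinearMap.ker S.toFun).map S.domain.subtype ⊓ (LinearMap.ker T†.toFun).map T†.domain.subtype)ᗮ →
        ‖g‖ ^ 2 ≤ C ^ 2 * (‖T† ⟨g, hgT⟩‖ ^ 2 + ‖S ⟨g, hgS⟩‖ ^ 2))
    (f : F) : ‖K f‖ ≤ C ^ 2 * ‖f‖ := by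
  obtain ⟨hf, ho, -⟩ := hK f
  have h1 := h14 (K f) (laplacian_domain_le_adjoint_domain hdom hf) (laplacian_domain_le_domain hdom hf) ho
  have h2 := norm_sq_add_norm_sq_green_le hdT hdS hdom hval hK f hf
  have h3 : ‖K f‖ * ‖K f‖ ≤ C ^ 2 * ‖f‖ * ‖K f‖ := by
    rw [← pow_two]
    calc ‖K f‖ ^ 2 ≤ C ^ 2 * (‖K f‖ * ‖f‖) := h1.trans (mul_le_mul_of_nonneg_left h2 (sq_nonneg C))
      _ = C ^ 2 * ‖f‖ * ‖K f‖ := by ring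
  by_cases h0 : ‖K f‖ = 0
  · rw [h0]; positivity
  · exact le_of_mul_le_mul_right h3 (lt_of_le_of_ne (norm_nonneg _) (Ne.symm h0))

omit [CompleteSpace G] in
/-- **`‖K‖ ≤ C²`** under the basic estimate (1.1.4). [cite: Hormander1965, §1.1 Thm 1.1.2 (1.1.4);
ArnoldFalkWinther2010, Thm 3.1] -/
theorem opNorm_green_le_of_basic_estimate (hdT : Dense (T.domain : Set E)) (hdS : Dense (S.domain : Set F))
    (hdom : ∀ x : F, x ∈ L.domain ↔ (∃ hxT : x ∈ T†.domain, T† ⟨x, hxT⟩ ∈ T.domain) ∧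
      (∃ hxS : x ∈ S.domain, S ⟨x, hxS⟩ ∈ S†.domain))
    (hval : ∀ (x : L.domain) (hxT : (x : F) ∈ T†.domain) (hTx : T† ⟨x, hxT⟩ ∈ T.domain)
      (hxS : (x : F) ∈ S.domain) (hSx : S ⟨x, hxS⟩ ∈ S†.domain),
      L x = T ⟨T† ⟨x, hxT⟩, hTx⟩ + S† ⟨S ⟨x, hxS⟩, hSx⟩)
    (hK : ∀ f : F, ∃ h : K f ∈ L.domain,
      K f ∈ ((LinearMap.ker S.toFun).map S.domain.subtype ⊓ (LinearMap.ker T†.toFun).map T†.domain.subtype)ᗮ ∧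
      f - L ⟨K f, h⟩ ∈ (LinearMap.ker S.toFun).map S.domain.subtype ⊓
        (LinearMap.ker T†.toFun).map T†.domain.subtype)
    {C : ℝ}
    (h14 : ∀ (g : F) (hgT : g ∈ T†.domain) (hgS : g ∈ S.domain),
      g ∈ ((LinearMap.ker S.toFun).map S.domain.subtype ⊓ (LinearMap.ker T†.toFun).map T†.domain.subtype)ᗮ →
        ‖g‖ ^ 2 ≤ C ^ 2 * (‖T† ⟨g, hgT⟩‖ ^ 2 + ‖S ⟨g, hgS⟩‖ ^ 2)) :
    ‖K‖ ≤ C ^ 2 :=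
  ContinuousLinearMap.opNorm_le_bound K (sq_nonneg C)
    (fun f ↦ norm_green_le_of_basic_estimate hdT hdS hdom hval hK h14 f)

omit [CompleteSpace G] in
/-- **`‖T*Kf‖ ≤ |C| ‖f‖`** under (1.1.4) (`‖σ‖ ≤ c‖f‖`, `σ = d*Kf`: `‖T*u‖² ≤ Re (u, f) ≤ ‖u‖‖f‖ ≤ C²‖f‖²`).
[cite: ArnoldFalkWinther2010, Thm 3.1; Hormander1965, §1.1 (1.1.4)] -/
theorem norm_adjoint_green_le_of_basic_estimate (hdT : Dense (T.domain : Set E))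
    (hdS : Dense (S.domain : Set F))
    (hdom : ∀ x : F, x ∈ L.domain ↔ (∃ hxT : x ∈ T†.domain, T† ⟨x, hxT⟩ ∈ T.domain) ∧
      (∃ hxS : x ∈ S.domain, S ⟨x, hxS⟩ ∈ S†.domain))
    (hval : ∀ (x : L.domain) (hxT : (x : F) ∈ T†.domain) (hTx : T† ⟨x, hxT⟩ ∈ T.domain)
      (hxS : (x : F) ∈ S.domain) (hSx : S ⟨x, hxS⟩ ∈ S†.domain),
      L x = T ⟨T† ⟨x, hxT⟩, hTx⟩ + S† ⟨S ⟨x, hxS⟩, hSx⟩)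
    (hK : ∀ f : F, ∃ h : K f ∈ L.domain,
      K f ∈ ((LinearMap.ker S.toFun).map S.domain.subtype ⊓ (LinearMap.ker T†.toFun).map T†.domain.subtype)ᗮ ∧
      f - L ⟨K f, h⟩ ∈ (LinearMap.ker S.toFun).map S.domain.subtype ⊓
        (LinearMap.ker T†.toFun).map T†.domain.subtype)
    {C : ℝ}
    (h14 : ∀ (g : F) (hgT : g ∈ T†.domain) (hgS : g ∈ S.domain),
      g ∈ ((LinearMap.ker S.toFun).map S.domain.subtype ⊓ (LinearMap.ker T†.toFun).map T†.domain.subtype)ᗮ →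
        ‖g‖ ^ 2 ≤ C ^ 2 * (‖T† ⟨g, hgT⟩‖ ^ 2 + ‖S ⟨g, hgS⟩‖ ^ 2))
    (f : F) (hxT : K f ∈ T†.domain) : ‖T† ⟨K f, hxT⟩‖ ≤ |C| * ‖f‖ := by
  obtain ⟨hf, -, -⟩ := hK f
  have h2 := norm_sq_add_norm_sq_green_le hdT hdS hdom hval hK f hf
  have h3 := norm_green_le_of_basic_estimate hdT hdS hdom hval hK h14 f
  refine (pow_le_pow_iff_left₀ (norm_nonneg _) (by positivity) two_ne_zero).1 ?_
  calc ‖T† ⟨K f, hxT⟩‖ ^ 2 ≤ ‖K f‖ * ‖f‖ := le_of_add_le_of_nonneg_left h2 (sq_nonneg _)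
    _ ≤ C ^ 2 * ‖f‖ * ‖f‖ := mul_le_mul_of_nonneg_right h3 (norm_nonneg _)
    _ = (|C| * ‖f‖) ^ 2 := by rw [mul_pow, sq_abs]; ring

omit [CompleteSpace G] in
/-- **`‖SKf‖ ≤ |C| ‖f‖`** under (1.1.4) (`‖du‖ ≤ ‖u‖_V ≤ c‖f‖`). [cite: ArnoldFalkWinther2010, Thm 3.1;
Hormander1965, §1.1 (1.1.4)] -/
theorem norm_apply_green_le_of_basic_estimate (hdT : Dense (T.domain : Set E))
    (hdS : Dense (S.domain : Set F))
    (hdom : ∀ x : F, x ∈ L.domain ↔ (∃ hxT : x ∈ T†.domain, T† ⟨x, hxT⟩ ∈ T.domain) ∧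
      (∃ hxS : x ∈ S.domain, S ⟨x, hxS⟩ ∈ S†.domain))
    (hval : ∀ (x : L.domain) (hxT : (x : F) ∈ T†.domain) (hTx : T† ⟨x, hxT⟩ ∈ T.domain)
      (hxS : (x : F) ∈ S.domain) (hSx : S ⟨x, hxS⟩ ∈ S†.domain),
      L x = T ⟨T† ⟨x, hxT⟩, hTx⟩ + S† ⟨S ⟨x, hxS⟩, hSx⟩)
    (hK : ∀ f : F, ∃ h : K f ∈ L.domain,
      K f ∈ ((LinearMap.ker S.toFun).map S.domain.subtype ⊓ (LinearMap.ker T†.toFun).map T†.domain.subtype)ᗮ ∧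
      f - L ⟨K f, h⟩ ∈ (LinearMap.ker S.toFun).map S.domain.subtype ⊓
        (LinearMap.ker T†.toFun).map T†.domain.subtype)
    {C : ℝ}
    (h14 : ∀ (g : F) (hgT : g ∈ T†.domain) (hgS : g ∈ S.domain),
      g ∈ ((LinearMap.ker S.toFun).map S.domain.subtype ⊓ (LinearMap.ker T†.toFun).map T†.domain.subtype)ᗮ →
        ‖g‖ ^ 2 ≤ C ^ 2 * (‖T† ⟨g, hgT⟩‖ ^ 2 + ‖S ⟨g, hgS⟩‖ ^ 2))
    (f : F) (hxS : K f ∈ S.domain) : ‖S ⟨K f, hxS⟩‖ ≤ |C| * ‖f‖ := by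
  obtain ⟨hf, -, -⟩ := hK f
  have h2 := norm_sq_add_norm_sq_green_le hdT hdS hdom hval hK f hf
  have h3 := norm_green_le_of_basic_estimate hdT hdS hdom hval hK h14 f
  refine (pow_le_pow_iff_left₀ (norm_nonneg _) (by positivity) two_ne_zero).1 ?_
  calc ‖S ⟨K f, hxS⟩‖ ^ 2 ≤ ‖K f‖ * ‖f‖ := le_of_add_le_of_nonneg_right h2 (sq_nonneg _)
    _ ≤ C ^ 2 * ‖f‖ * ‖f‖ := mul_le_mul_of_nonneg_right h3 (norm_nonneg _)
    _ = (|C| * ‖f‖) ^ 2 := by rw [mul_pow, sq_abs]; ring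

end Bounds

end Literature.Analysis.InnerProduct
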